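import Summits.Ventures.Crystal3D.StickySpheres.SmallContactTable
import Summits.Ventures.Crystal3D.StickySpheres.ContactGraphFilters
import Summits.Ventures.Crystal3D.StickySpheres.NoK5
import Summits.Ventures.Crystal3D.StickySpheres.FiveRing
import Summits.Ventures.Crystal3D.StickySpheres.SevenVertexSearch
import HarnessLib

/-!
# `C(7) = 15` unconditionally, and the contact-number table up to twelve balls from the sweeps `S(n)`, `n ≥ 8`

Venture `Crystal3D` (cell `pub-crystal3d`, seat p2), continuation of `SmallContactValues.lean`.

PROVED OUTRIGHT here: **every packing of seven unit balls in `ℝ³` has at most fifteen contacts**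
(`numContacts_le_fifteen`), hence `S(15, 7)` (`stratumHypothesis_seven`) and **`C(7) = 15`** (`maxContacts_three_seven_eq`)
with no census hypothesis. The proof is the cell's reduction `T(7)` carried out inside the kernel: with `≥ 16` of the
`21` pairs touching, the combinatorial search `SevenSearch.exists_pattern` (`SevenVertexSearch.lean`, `decide +kernel`)
produces a labelled `K₅`, `K_{3,3}` or five-ring `K₂ ∨ C₅` among the touching pairs, refuted respectively by
`no_contact_clique_five` (no five mutually touching balls), `card_common_contactNeighbors_three_le_two'` (three balls
have at most two common neighbours) and `no_five_ring` (`FiveRing.lean`: five tetrahedra do not close up around an edge).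

CONDITIONAL (hypotheses named exactly, building on p3's `SmallContactTable.lean`): since `S_d(15, 7)` now holds for every
minimum degree `d` (`stratumHypothesisMinDeg_seven`), the table theorem `maxContacts_eq_contactTable` needs the census strata
only from EIGHT balls on: `maxContacts_eq_contactTable_of_strata_ge_eight` derives `C(n) = contactTable n` (`6, 9, 12, 15, 18,
21, 25, 29, 33, 36` for `n = 4, …, 13`) for all `4 ≤ n ≤ 13` from `S_{d_n}(c_n, n)`, `8 ≤ n ≤ 13`; the rows are spelled out:
`C(8) = 18 ⇐ S_4(18,8)`; `C(9) = 21 ⇐ S_4(18,8), S_4(21,9)`; `C(10) = 25 ⇐ …, S_5(25,10)`; `C(11) = 29 ⇐ …, S_5(29,11)`;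
`C(12) = 33 ⇐ …, S_5(33,12)`; `C(13) = 36 ⇐ …, S_4(36,13)`. The strata (`StratumHypothesisMinDeg d t n`: no packing of `n`
balls with all coordinations `≥ d` has more than `t` contacts) are what the cell's exact enumeration certifies; they are NOT
proved here. Nothing about crystallization.
-/

noncomputable section

open Finset
open scoped BigOperators

namespace Summit.Ventures.Crystal3D

open SevenSearch

/-! ### 1. Seven balls have at most fifteen contacts -/

/-- `no_five_ring` with the sixteen contacts listed pair by pair (orientation of `SevenSearch.ringEdges`). [folklore] -/
theorem no_five_ring' {P Q A B C D E : EuclideanSpace ℝ (Fin 3)} (hPQ : dist P Q = 1)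
    (hPA : dist P A = 1) (hPB : dist P B = 1) (hPC : dist P C = 1) (hPD : dist P D = 1) (hPE : dist P E = 1)
    (hQA : dist Q A = 1) (hQB : dist Q B = 1) (hQC : dist Q C = 1) (hQD : dist Q D = 1) (hQE : dist Q E = 1)
    (hAB : dist A B = 1) (hBC : dist B C = 1) (hCD : dist C D = 1) (hDE : dist D E = 1) (hEA : dist E A = 1)
    (hBD : 1 ≤ dist B D) (hAD : 1 ≤ dist A D) : False := by
  rw [dist_comm] at hPA hPB hPC hPD hPE hQA hQB hQC hQD hQE
  refine no_five_ring P Q ![A, B, C, D, E] hPQ ?_ ?_ hAB hBC hCD hDE hEA hBD hAD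
  · intro i
    fin_cases i
    · exact hPA
    · exact hPB
    · exact hPC
    · exact hPD
    · exact hPE
  · intro i
    fin_cases i
    · exact hQA
    · exact hQB
    · exact hQC
    · exact hQD
    · exact hQE

/-- **Seven balls have at most fifteen contacts** (no hypothesis on the packing). [folklore] -/
theorem numContacts_le_fifteen {x : Fin 7 → EuclideanSpace ℝ (Fin 3)} (hx : IsUnitPacking x) :
    numContacts x ≤ 15 := by
  classical
  by_contra h15
  push Not at h15
  -- the non-touching pairs and their edge slots
  set NC : Finset (Fin 7 × Fin 7) := univ.filter fun p => p.1 < p.2 ∧ dist (x p.1) (x p.2) ≠ 1 with hNC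
  set S : Finset ℕ := NC.image fun p => pidx p.1 p.2 with hSdef
  have hLT : (univ.filter fun p : Fin 7 × Fin 7 => p.1 < p.2).card = 21 := by decide
  have hunion : contactPairs x ∪ NC = univ.filter fun p : Fin 7 × Fin 7 => p.1 < p.2 := by
    ext p
    simp only [mem_union, mem_contactPairs, hNC, mem_filter, mem_univ, true_and]
    tauto
  have hdisj : Disjoint (contactPairs x) NC := by
    rw [Finset.disjoint_left]
    intro p hp hq
    rw [mem_contactPairs] at hp
    rw [hNC, mem_filter] at hq
    exact hq.2.2 hp.2
  have hcardNC : NC.card ≤ 5 := by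
    have h := card_union_of_disjoint hdisj
    rw [hunion, hLT] at h
    unfold numContacts at h15
    omega
  have hScard : S.card ≤ 5 := card_image_le.trans hcardNC
  have hS21 : ∀ i ∈ S, i < 21 := by
    intro i hi
    obtain ⟨p, hp, rfl⟩ := mem_image.1 hi
    rw [hNC, mem_filter] at hp
    exact pidx_lt p.1 p.2 (ne_of_lt hp.2.1)
  -- a pair whose slot is not missing is a contact
  have hcon : ∀ a b : Fin 7, a ≠ b → pidx a b ∉ S → dist (x a) (x b) = 1 := by
    intro a b hab hS
    by_contra hd
    apply hS
    rcases lt_or_gt_of_ne hab with hlt | hlt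
    · have hmem : (a, b) ∈ NC := by
        rw [hNC, mem_filter]
        exact ⟨mem_univ _, hlt, hd⟩
      exact mem_image.2 ⟨(a, b), hmem, rfl⟩
    · have hmem : (b, a) ∈ NC := by
        rw [hNC, mem_filter]
        exact ⟨mem_univ _, hlt, fun h => hd (by rw [dist_comm]; exact h)⟩
      exact mem_image.2 ⟨(b, a), hmem, pidx_comm b a⟩
  rcases exists_pattern S hS21 hScard with ⟨t, ht, hfree⟩ | ⟨t, ht, hfree⟩ | ⟨t, ht, hfree⟩
  · -- a `K₅` among the contacts: five mutually touching balls
    have hv := k5Tuples_valid t ht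
    obtain ⟨a, b, c, d, e⟩ := t
    have H : ∀ ed ∈ k5Edges (a, b, c, d, e), dist (x ed.1) (x ed.2) = 1 :=
      fun ed hed => hcon _ _ (hv ed hed) (hfree ed hed)
    simp only [k5Edges, List.forall_mem_cons, List.not_mem_nil, false_implies, implies_true, and_true] at H hv
    obtain ⟨hab, hac, had, hae, hbc, hbd, hbe, hcd, hce, hde⟩ := H
    obtain ⟨nab, nac, nad, nae, nbc, nbd, nbe, ncd, nce, nde⟩ := hv
    have hcard : ({a, b, c, d, e} : Finset (Fin 7)).card = 5 := by
      rw [card_insert_of_notMem (by simp [nab, nac, nad, nae]), card_insert_of_notMem (by simp [nbc, nbd, nbe]),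
        card_insert_of_notMem (by simp [ncd, nce]), card_pair nde]
    refine no_contact_clique_five x {a, b, c, d, e} hcard fun i hi j hj hij => ?_
    simp only [mem_insert, mem_singleton] at hi hj
    rcases hi with rfl | rfl | rfl | rfl | rfl <;> rcases hj with rfl | rfl | rfl | rfl | rfl <;>
      first
      | exact absurd rfl hij
      | assumption
      | (rw [dist_comm]; assumption)
  · -- a `K_{3,3}` among the contacts: three balls with three common neighbours
    have hv := k33Tuples_valid t ht
    obtain ⟨a, b, c, d, e, f⟩ := t
    obtain ⟨hv1, nab, nac, nbc, nde, ndf, nef⟩ := hv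
    have H : ∀ ed ∈ k33Edges (a, b, c, d, e, f), dist (x ed.1) (x ed.2) = 1 :=
      fun ed hed => hcon _ _ (hv1 ed hed) (hfree ed hed)
    simp only [k33Edges, List.forall_mem_cons, List.not_mem_nil, false_implies, implies_true, and_true] at H hv1
    obtain ⟨had, hae, haf, hbd, hbe, hbf, hcd, hce, hcf⟩ := H
    obtain ⟨nad, nae, naf, nbd, nbe, nbf, ncd, nce, ncf⟩ := hv1
    have hsub : ({d, e, f} : Finset (Fin 7)) ⊆
        contactNeighbors x a ∩ contactNeighbors x b ∩ contactNeighbors x c := by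
      intro j hj
      simp only [mem_insert, mem_singleton] at hj
      simp only [mem_inter, mem_contactNeighbors]
      rcases hj with rfl | rfl | rfl
      · exact ⟨⟨⟨nad.symm, had⟩, nbd.symm, hbd⟩, ncd.symm, hcd⟩
      · exact ⟨⟨⟨nae.symm, hae⟩, nbe.symm, hbe⟩, nce.symm, hce⟩
      · exact ⟨⟨⟨naf.symm, haf⟩, nbf.symm, hbf⟩, ncf.symm, hcf⟩
    have h3 : ({d, e, f} : Finset (Fin 7)).card = 3 := by
      rw [card_insert_of_notMem (by simp [nde, ndf]), card_pair nef]
    have h2 : (contactNeighbors x a ∩ contactNeighbors x b ∩ contactNeighbors x c).card ≤ 2 :=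
      card_common_contactNeighbors_three_le_two' hx nab nac nbc
    have h3' := card_le_card hsub
    rw [h3] at h3'
    omega
  · -- a five-ring among the contacts: five tetrahedra around the edge `pq`
    have hv := ringTuples_valid t ht
    obtain ⟨p, q, a, b, c, d, e⟩ := t
    obtain ⟨hv1, nbd, nad⟩ := hv
    have H : ∀ ed ∈ ringEdges (p, q, a, b, c, d, e), dist (x ed.1) (x ed.2) = 1 :=
      fun ed hed => hcon _ _ (hv1 ed hed) (hfree ed hed)
    simp only [ringEdges, List.forall_mem_cons, List.not_mem_nil, false_implies, implies_true, and_true] at H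
    obtain ⟨hpq, hpa, hpb, hpc, hpd, hpe, hqa, hqb, hqc, hqd, hqe, hab, hbc, hcd, hde, hea⟩ := H
    exact no_five_ring' hpq hpa hpb hpc hpd hpe hqa hqb hqc hqd hqe hab hbc hcd hde hea
      (hx.one_le_dist nbd) (hx.one_le_dist nad)

/-- **`S(15, 7)` holds outright.** [folklore] -/
theorem stratumHypothesis_seven : StratumHypothesis 15 7 := fun _ hx _ => numContacts_le_fifteen hx

/-- **`C(7) = 15`**, unconditionally (the pentagonal-bipyramid value of Arkus–Manoharan–Brenner / Hoy et al.). [folklore] -/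
theorem maxContacts_three_seven_eq : maxContacts 3 7 = 15 := maxContacts_three_seven stratumHypothesis_seven

/-! ### 2. The table up to thirteen balls needs the census only from eight balls on -/

/-- **`S_d(15, 7)` for every minimum degree `d`** (in particular p3's `S_4(15,7)`): discharged. [folklore] -/
theorem stratumHypothesisMinDeg_seven (d : ℕ) : StratumHypothesisMinDeg d 15 7 :=
  fun _ hx _ => numContacts_le_fifteen hx

/-- `C(7)` is the table value (base case for the induction from seven balls on). [folklore] -/
theorem maxContacts_three_seven_eq_contactTable : maxContacts 3 7 = contactTable 7 := by
  simpa [contactTable] using maxContacts_three_seven_eq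

/-- The induction of `SmallContactTable.lean` restarted at `n₁ = 7`: for `7 ≤ n₂ ≤ 13`, the strata `S_{d_n}(c_n, n)` for
`8 ≤ n ≤ n₂` give `C(n) = contactTable n` for `7 ≤ n ≤ n₂`. [folklore] -/
theorem maxContacts_eq_contactTable_from_seven {n₂ : ℕ} (hn₂ : n₂ ≤ 13)
    (hS : ∀ n, 8 ≤ n → n ≤ n₂ → StratumHypothesisMinDeg (minDegTable n) (contactTable n) n)
    {n : ℕ} (h7 : 7 ≤ n) (hn : n ≤ n₂) : maxContacts 3 n = contactTable n := by
  refine maxContacts_eq_of_stratumMinDeg contactTable minDegTable (n₁ := 7) (n₂ := n₂)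
    maxContacts_three_seven_eq_contactTable ?_ ?_ ?_ n h7 hn
  · intro m hm hm2
    have hm13 : m ≤ 13 := hm2.trans hn₂
    interval_cases m <;> simp [contactTable, minDegTable]
  · intro m hm hm2
    exact contactTable_le_maxContacts (by omega) (hm2.trans hn₂)
  · intro m hm hm2
    exact hS m (by omega) hm2

/-- **The table from the strata for `n ≥ 8` only.** If `S_{d_n}(c_n, n)` holds for `8 ≤ n ≤ 13` (`d_n = minDegTable n`,
`c_n = contactTable n`), then `C(n) = contactTable n` for every `4 ≤ n ≤ 13`; rows `n ≤ 7` are unconditional. [folklore] -/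
theorem maxContacts_eq_contactTable_of_strata_ge_eight
    (hS : ∀ n, 8 ≤ n → n ≤ 13 → StratumHypothesisMinDeg (minDegTable n) (contactTable n) n)
    {n : ℕ} (h4 : 4 ≤ n) (h13 : n ≤ 13) : maxContacts 3 n = contactTable n := by
  refine maxContacts_eq_contactTable (fun m h7 hm13 => ?_) h4 h13
  by_cases hm : m = 7
  · subst hm
    simpa [contactTable, minDegTable] using stratumHypothesisMinDeg_seven 4
  · exact hS m (by omega) hm13

/-- **Row `n = 8`: `C(8) = 18` from the single stratum `S_4(18, 8)`** (no contact graph on `8` vertices with minimum degree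
`≥ 4` and `≥ 19` edges). [folklore] -/
theorem maxContacts_three_eight_of_stratum (h8 : StratumHypothesisMinDeg 4 18 8) : maxContacts 3 8 = 18 := by
  have h := maxContacts_eq_contactTable_from_seven (n₂ := 8) (by norm_num)
    (by
      intro n hn hn'
      interval_cases n
      simpa [contactTable, minDegTable] using h8) (n := 8) (by norm_num) le_rfl
  simpa [contactTable] using h

/-- **Row `n = 9`: `C(9) = 21` from `S_4(18, 8)` and `S_4(21, 9)`.** [folklore] -/
theorem maxContacts_three_nine_of_strata (h8 : StratumHypothesisMinDeg 4 18 8) (h9 : StratumHypothesisMinDeg 4 21 9) :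
    maxContacts 3 9 = 21 := by
  have h := maxContacts_eq_contactTable_from_seven (n₂ := 9) (by norm_num)
    (by
      intro n hn hn'
      interval_cases n <;> simpa [contactTable, minDegTable]) (n := 9) (by norm_num) le_rfl
  simpa [contactTable] using h

/-- **Rows `n ≤ 9`: `C(n) = 3n − 6` for all `4 ≤ n ≤ 9` from the two strata `S_4(18, 8)`, `S_4(21, 9)`.** [folklore] -/
theorem maxContacts_eq_three_mul_sub_six_of_two_strata (h8 : StratumHypothesisMinDeg 4 18 8)
    (h9 : StratumHypothesisMinDeg 4 21 9) {n : ℕ} (h4 : 4 ≤ n) (h9' : n ≤ 9) : maxContacts 3 n = 3 * n - 6 := by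
  rcases Nat.lt_or_ge n 7 with hlt | h7
  · interval_cases n
    · simpa using maxContacts_three_four
    · simpa using maxContacts_three_five
    · simpa using maxContacts_three_six
  · have h := maxContacts_eq_contactTable_from_seven (n₂ := 9) (by norm_num)
      (by
        intro n hn hn'
        interval_cases n <;> simpa [contactTable, minDegTable]) h7 h9'
    have hn : n ≤ 9 := h9'
    simpa [contactTable, hn] using h

/-- **Row `n = 10`: `C(10) = 25` from `S_4(18, 8)`, `S_4(21, 9)`, `S_5(25, 10)`.** [folklore] -/
theorem maxContacts_three_ten_of_three_strata (h8 : StratumHypothesisMinDeg 4 18 8) (h9 : StratumHypothesisMinDeg 4 21 9)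
    (h10 : StratumHypothesisMinDeg 5 25 10) : maxContacts 3 10 = 25 := by
  have h := maxContacts_eq_contactTable_from_seven (n₂ := 10) (by norm_num)
    (by
      intro n hn hn'
      interval_cases n <;> simpa [contactTable, minDegTable]) (n := 10) (by norm_num) le_rfl
  simpa [contactTable] using h

/-- **Row `n = 11`: `C(11) = 29` from `S_4(18, 8)`, `S_4(21, 9)`, `S_5(25, 10)`, `S_5(29, 11)`.** [folklore] -/
theorem maxContacts_three_eleven_of_strata (h8 : StratumHypothesisMinDeg 4 18 8) (h9 : StratumHypothesisMinDeg 4 21 9)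
    (h10 : StratumHypothesisMinDeg 5 25 10) (h11 : StratumHypothesisMinDeg 5 29 11) : maxContacts 3 11 = 29 := by
  have h := maxContacts_eq_contactTable_from_seven (n₂ := 11) (by norm_num)
    (by
      intro n hn hn'
      interval_cases n <;> simpa [contactTable, minDegTable]) (n := 11) (by norm_num) le_rfl
  simpa [contactTable] using h

/-- **Row `n = 12`: `C(12) = 33` from the five strata `S_4(18,8)`, `S_4(21,9)`, `S_5(25,10)`, `S_5(29,11)`, `S_5(33,12)`.**
[folklore] -/
theorem maxContacts_three_twelve_of_strata (h8 : StratumHypothesisMinDeg 4 18 8) (h9 : StratumHypothesisMinDeg 4 21 9)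
    (h10 : StratumHypothesisMinDeg 5 25 10) (h11 : StratumHypothesisMinDeg 5 29 11)
    (h12 : StratumHypothesisMinDeg 5 33 12) : maxContacts 3 12 = 33 := by
  have h := maxContacts_eq_contactTable_from_seven (n₂ := 12) (by norm_num)
    (by
      intro n hn hn'
      interval_cases n <;> simpa [contactTable, minDegTable]) (n := 12) (by norm_num) le_rfl
  simpa [contactTable] using h

/-- **Row `n = 13`: `C(13) = 36` from the six strata `S_4(18,8)`, …, `S_5(33,12)`, `S_4(36,13)`.** [folklore] -/
theorem maxContacts_three_thirteen_of_strata (h8 : StratumHypothesisMinDeg 4 18 8) (h9 : StratumHypothesisMinDeg 4 21 9)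
    (h10 : StratumHypothesisMinDeg 5 25 10) (h11 : StratumHypothesisMinDeg 5 29 11)
    (h12 : StratumHypothesisMinDeg 5 33 12) (h13 : StratumHypothesisMinDeg 4 36 13) : maxContacts 3 13 = 36 := by
  have h := maxContacts_eq_contactTable_from_seven (n₂ := 13) (by norm_num)
    (by
      intro n hn hn'
      interval_cases n <;> simpa [contactTable, minDegTable]) (n := 13) (by norm_num) le_rfl
  simpa [contactTable] using h

end Summit.Ventures.Crystal3D

end
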